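import Summits.QuantumFields.YangMills.Theorems.LuscherReductionTwistedTraceScalingStepForm
import Summits.QuantumFields.YangMills.Theorems.LuscherReductionTwistedTraceScalingMagneticQuadratic
import Summits.QuantumFields.YangMills.Theorems.FemtoTransferGapAdjoint
import HarnessLib

/-!
# Locality of the kinetic step: `E_β(1, W) = Π_e e^{2β u₀(W_e)}`, and a step with one link at `1 − u₀(W_e) ≥ δ` is suppressed by `e^{−2βδ}`
# (lane B of S-BASE, crux `TwistedTraceScaling` stmt-QuantumFields-20203; covariant reformulation of the Laplace step, blueprint §5, brick c4 part ii)

In the step form of the transfer operator (`…StepForm.transferApply_eq_integral_step'`) the electric weight is `E_β(1, W) = Π_e w_β(W_e⁻¹) =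
Π_e exp(2β u₀(W_e))` (the trace is inversion invariant, tree `linkW_inv`).  Hence `E_β(1, W) ≤ e^{2β|E|}` always, and `E_β(1, W) ≤ e^{2β|E|} e^{−2βδ}` as soon as ONE
link has `1 − u₀(W_e) ≥ δ`: steps leaving the `δ`-neighbourhood of the identity are exponentially suppressed — the `W`-integral localises at
`|w| ~ β^{−1/2}`, uniformly in the configuration `U` around which the step is taken.
HONEST FRAMING: bookkeeping; femto rung R2b1 (stub of a child of a CONDITIONAL route); not a gap, not Clay.
-/

set_option autoImplicit false

noncomputable section

open scoped Matrix BigOperators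
open Literature.MathematicalPhysics.QuantumFieldTheory
open Literature.MathematicalPhysics.QuantumLattice

namespace Summit.QuantumFields.YangMills.Theorems.FemtoTransferGap.TwoLattice.Cov

open Summit.QuantumFields.YangMills.Theorems.FemtoTransferGap

variable {L : ℕ} [NeZero L]

/-- `w_β(W) = exp(2β u₀(W))`. [folklore] -/
theorem linkW_eq_exp_scalarPart (β : ℝ) (W : SU2) : linkW β W = Real.exp (2 * β * scalarPart W) := by
  unfold linkW; rw [re_trace_eq_two_mul_scalarPart]; ring_nf

/-- ★ `E_β(1, W) = Π_e exp(2β u₀(W_e))`. [cite: SeilerLNP1982, §3] -/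
theorem latE_one_left_eq (β : ℝ) (W : GaugeConfig 3 L SU2) :
    latE L β 1 W = ∏ e : Edge 3 L, Real.exp (2 * β * scalarPart (W e)) := by
  unfold latE
  refine Finset.prod_congr rfl fun e _ => ?_
  rw [Pi.one_apply, one_mul, linkW_inv, linkW_eq_exp_scalarPart]

/-- ★ **One far link suppresses the step**: if `1 − u₀(W_{e₀}) ≥ δ` for some link and `β ≥ 0`, then `E_β(1, W) ≤ e^{2β|E|} · e^{−2βδ}`.
[cite: SeilerLNP1982, §3] -/
theorem latE_one_left_le_of_far {β : ℝ} (hβ : 0 ≤ β) (W : GaugeConfig 3 L SU2) {e₀ : Edge 3 L} {δ : ℝ}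
    (hfar : δ ≤ 1 - scalarPart (W e₀)) :
    latE L β 1 W ≤ Real.exp (2 * β) ^ Fintype.card (Edge 3 L) * Real.exp (-(2 * β * δ)) := by
  rw [latE_one_left_eq]
  have hle1 : ∀ e, Real.exp (2 * β * scalarPart (W e)) ≤ Real.exp (2 * β) := fun e => by
    refine Real.exp_le_exp.2 ?_
    have := (abs_le.mp (abs_scalarPart_le (W e))).2
    nlinarith
  -- split off the factor `e₀`
  rw [← Finset.mul_prod_erase Finset.univ _ (Finset.mem_univ e₀)]
  have hrest : ∏ e ∈ Finset.univ.erase e₀, Real.exp (2 * β * scalarPart (W e)) ≤ Real.exp (2 * β) ^ (Fintype.card (Edge 3 L) - 1) := by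
    have hcard : (Finset.univ.erase e₀).card = Fintype.card (Edge 3 L) - 1 := by
      rw [Finset.card_erase_of_mem (Finset.mem_univ e₀), Finset.card_univ]
    rw [← hcard, ← Finset.prod_const]
    exact Finset.prod_le_prod (fun e _ => (Real.exp_pos _).le) fun e _ => hle1 e
  have h0 : Real.exp (2 * β * scalarPart (W e₀)) ≤ Real.exp (2 * β) * Real.exp (-(2 * β * δ)) := by
    rw [← Real.exp_add]
    exact Real.exp_le_exp.2 (by nlinarith)
  have hn : 1 ≤ Fintype.card (Edge 3 L) := Fintype.card_pos_iff.mpr ⟨e₀⟩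
  calc Real.exp (2 * β * scalarPart (W e₀)) * ∏ e ∈ Finset.univ.erase e₀, Real.exp (2 * β * scalarPart (W e))
      ≤ (Real.exp (2 * β) * Real.exp (-(2 * β * δ))) * Real.exp (2 * β) ^ (Fintype.card (Edge 3 L) - 1) :=
        mul_le_mul h0 hrest (Finset.prod_nonneg fun e _ => (Real.exp_pos _).le) (by positivity)
    _ = Real.exp (2 * β) ^ Fintype.card (Edge 3 L) * Real.exp (-(2 * β * δ)) := by
        rw [show Real.exp (2 * β) ^ Fintype.card (Edge 3 L) = Real.exp (2 * β) * Real.exp (2 * β) ^ (Fintype.card (Edge 3 L) - 1) by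
          rw [← pow_succ', Nat.sub_add_cancel hn]]
        ring

/-- In the step form, the far part of the `W`-integral of any `|φ| ≤ C` is bounded by `e^{2β|E|} e^{−2βδ} · C` pointwise in the integrand
(the magnetic factor is `≤ 1`). [cite: SeilerLNP1982, §3] -/
theorem step_integrand_le_of_far {β : ℝ} (hβ : 0 ≤ β) (U W : GaugeConfig 3 L SU2) {e₀ : Edge 3 L} {δ : ℝ}
    (hfar : δ ≤ 1 - scalarPart (W e₀)) {φ : GaugeConfig 3 L SU2 → ℝ} {C : ℝ} (hφ : ∀ V, |φ V| ≤ C) :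
    |transferKernel su2Rep β U (W * U) * φ (W * U)| ≤ Real.exp (2 * β) ^ Fintype.card (Edge 3 L) * Real.exp (-(2 * β * δ)) * C := by
  rw [transferKernel_mul_left_eq, abs_mul]
  have hmag : Real.exp (-(β / 2) * (wilsonAction su2Rep U + wilsonAction su2Rep (W * U))) ≤ 1 := by
    rw [Real.exp_le_one_iff]
    have := wilsonAction_su2_nonneg_lat U; have := wilsonAction_su2_nonneg_lat (W * U)
    nlinarith
  have hK : |latE L β 1 W * Real.exp (-(β / 2) * (wilsonAction su2Rep U + wilsonAction su2Rep (W * U)))| ≤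
      Real.exp (2 * β) ^ Fintype.card (Edge 3 L) * Real.exp (-(2 * β * δ)) := by
    rw [abs_of_nonneg (mul_nonneg (latE_pos β _ _).le (Real.exp_pos _).le)]
    calc latE L β 1 W * Real.exp (-(β / 2) * (wilsonAction su2Rep U + wilsonAction su2Rep (W * U)))
        ≤ latE L β 1 W * 1 := mul_le_mul_of_nonneg_left hmag (latE_pos β _ _).le
      _ ≤ _ := by rw [mul_one]; exact latE_one_left_le_of_far hβ W hfar
  exact mul_le_mul hK (hφ _) (abs_nonneg _) (by positivity)

end Summit.QuantumFields.YangMills.Theorems.FemtoTransferGap.TwoLattice.Cov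

end
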